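import Mathlib

/-!
# `TwTipContinuation` (stmt-HubbardSuperconductivity-1700) — the ABSTRACT Tip-shape is false (negative-side support)

Route `ThermalWedge`, crux rank 6. In normal form (see `Negative/TipNormalForm.lean`) the crux says:
for the seeded family `H(g) = H₀ − g·P` (`P = L⁻²(Δᴴ Δ) ≥ 0`), every-ground-state order
`⟨P⟩ ≥ c` at seed `g = 1/20` forces every-ground-state order `⟨P⟩ > 0` at seed `g = 0`. The only
structure available to pure bookkeeping is: `H₀` symmetric, `P ≥ 0`, the seed enters linearly, and
(consequently) the order is monotone in `g`. This file records, as a sorry-free theorem, that this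
structure does NOT imply the Tip-shape: the two-level family `diag(0, 1 − 40g)` with `P = diag(0, 40)`
is lit (`⟨P⟩ = 40`) for `g > 1/40` and dark (`⟨P⟩ = 0` on a ground state) for `g < 1/40` — a level
crossing strictly inside `(0, 1/20)`. In the many-body problem this is the scenario "a competing state
wins at `g = 0`"; the crux, if true, is true for model-specific (Kohn–Luttinger) reasons only.

* `not_abstractTipShape` — `¬ ∀ (A P : Matrix (Fin 2) (Fin 2) ℝ), P.PosSemidef → (every unit
  minimiser `v` of `⟨v,(A − P/20)v⟩` has `1 ≤ ⟨v,Pv⟩`) → (every unit minimiser of `⟨v,Av⟩` has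
  `0 < ⟨v,Pv⟩`)`.

Elementary linear algebra (level crossing of a `2 × 2` diagonal family); folklore.
-/

namespace Summit.HubbardSuperconductivity.TwTipContinuation.Negative

open Matrix

/-- `⟨v, (A − gP) v⟩ = (1 − 40g) v₁²` for `A = diag(0,1)`, `P = diag(0,40)`. [folklore] -/
theorem toy_form (g : ℝ) (v : Fin 2 → ℝ) :
    v ⬝ᵥ (Matrix.diagonal ![(0 : ℝ), 1] - g • Matrix.diagonal ![(0 : ℝ), 40]) *ᵥ v =
      (1 - 40 * g) * v 1 ^ 2 := by
  simp [Matrix.mulVec, dotProduct, Fin.sum_univ_two, Matrix.diagonal, Matrix.sub_apply]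
  ring

/-- `⟨v, P v⟩ = 40 v₁²`. [folklore] -/
theorem toy_formP (v : Fin 2 → ℝ) : v ⬝ᵥ Matrix.diagonal ![(0 : ℝ), 40] *ᵥ v = 40 * v 1 ^ 2 := by
  simp [Matrix.mulVec, dotProduct, Fin.sum_univ_two, Matrix.diagonal]
  ring

/-- `⟨v, A v⟩ = v₁²`. [folklore] -/
theorem toy_formA (v : Fin 2 → ℝ) : v ⬝ᵥ Matrix.diagonal ![(0 : ℝ), 1] *ᵥ v = v 1 ^ 2 := by
  simp [Matrix.mulVec, dotProduct, Fin.sum_univ_two, Matrix.diagonal]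
  ring

/-- `‖v‖² = v₀² + v₁²`. [folklore] -/
theorem toy_norm (v : Fin 2 → ℝ) : v ⬝ᵥ v = v 0 ^ 2 + v 1 ^ 2 := by
  simp [dotProduct, Fin.sum_univ_two]
  ring

/-- **The abstract Tip-shape is FALSE** (level crossing at `g = 1/40` inside `(0, 1/20)`): there are a
symmetric `A` and a positive semidefinite `P` on `ℝ²` such that every unit minimiser of the seeded form
`⟨v,(A − P/20)v⟩` has `⟨v,Pv⟩ ≥ 1` while some unit minimiser of `⟨v,Av⟩` has `⟨v,Pv⟩ = 0`. Hence no
argument using only hermiticity, `P ≥ 0`, linearity in the seed and monotonicity of the order can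
prove `TwTipContinuation`. [folklore] -/
theorem not_abstractTipShape :
    ¬ (∀ (A P : Matrix (Fin 2) (Fin 2) ℝ), P.PosSemidef →
        (∀ v : Fin 2 → ℝ, (v ⬝ᵥ v = 1 ∧ ∀ w : Fin 2 → ℝ, w ⬝ᵥ w = 1 →
            v ⬝ᵥ (A - (1 / 20 : ℝ) • P) *ᵥ v ≤ w ⬝ᵥ (A - (1 / 20 : ℝ) • P) *ᵥ w) →
          1 ≤ v ⬝ᵥ P *ᵥ v) →
        ∀ v : Fin 2 → ℝ, (v ⬝ᵥ v = 1 ∧ ∀ w : Fin 2 → ℝ, w ⬝ᵥ w = 1 → v ⬝ᵥ A *ᵥ v ≤ w ⬝ᵥ A *ᵥ w) →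
          0 < v ⬝ᵥ P *ᵥ v) := by
  intro h
  have hP : (Matrix.diagonal ![(0 : ℝ), 40]).PosSemidef :=
    Matrix.PosSemidef.diagonal (by intro i; fin_cases i <;> simp)
  -- lit at seed 1/20
  have hlit : ∀ v : Fin 2 → ℝ, (v ⬝ᵥ v = 1 ∧ ∀ w : Fin 2 → ℝ, w ⬝ᵥ w = 1 →
      v ⬝ᵥ (Matrix.diagonal ![(0 : ℝ), 1] - (1 / 20 : ℝ) • Matrix.diagonal ![(0 : ℝ), 40]) *ᵥ v ≤
        w ⬝ᵥ (Matrix.diagonal ![(0 : ℝ), 1] - (1 / 20 : ℝ) • Matrix.diagonal ![(0 : ℝ), 40]) *ᵥ w) →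
      1 ≤ v ⬝ᵥ Matrix.diagonal ![(0 : ℝ), 40] *ᵥ v := by
    rintro v ⟨hn, hmin⟩
    have h1 := hmin ![0, 1] (by simp [dotProduct, Fin.sum_univ_two])
    rw [toy_form, toy_form] at h1
    rw [toy_norm] at hn
    rw [toy_formP]
    simp at h1
    nlinarith
  -- dark at seed 0: `e₀` is a ground state of `A` with `⟨P⟩ = 0`
  have hgs : (![1, 0] : Fin 2 → ℝ) ⬝ᵥ ![1, 0] = 1 ∧ ∀ w : Fin 2 → ℝ, w ⬝ᵥ w = 1 →
      ![1, 0] ⬝ᵥ Matrix.diagonal ![(0 : ℝ), 1] *ᵥ ![1, 0] ≤ w ⬝ᵥ Matrix.diagonal ![(0 : ℝ), 1] *ᵥ w := by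
    refine ⟨by simp [dotProduct, Fin.sum_univ_two], fun w _ => ?_⟩
    rw [toy_formA, toy_formA]
    simp
    positivity
  have := h _ _ hP hlit ![1, 0] hgs
  rw [toy_formP] at this
  simp at this

end Summit.HubbardSuperconductivity.TwTipContinuation.Negative
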